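import Summits.RiemannHypothesis.RiemannHypothesis.Theorems.Splittings.RobinFiniteKernelPsiTheta
import HarnessLib

/-!
# RobinFiniteOneFactPsiTheta — `ψ − θ` and Nicolas's `J − K` from Büthe 2018 alone (BKLNW-free stub S4)

Cell rh-split, seat rh-split-robin-finite g17 (brief sha16 f79c5f09d8bcb036), card `cards/SPLIT-robin-finite.md` §24; carved verbatim from the
kernel-checked object `HOME/rh-split-robin-finite/g17/SketchG17-OneFact.lean` (rc 0, 0 warnings, 0 sorries, standard axioms).  Zero `def`,
zero `instance`, zero `notation`, no attribute changes, no `native_decide`.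

GEN 17 «ONE PRINT FACT», part 1/3.  In the tree's `c = 1` engine the RH-free print fact BKLNW 2021 §1.2 (`BroadbentEtAl2021_theta_rel_1e19`)
enters only through stub S4 (`RobinFiniteE1c.psiSubThetaFree_holds`: `ψ − θ ≤ 1.021√t + (4/3)t^{1/3}` on ALL of `[599, ∞)`).  Büthe 2018 Thm 2
ALONE (`θ(y) < y` on `[1, 10¹⁹]`) bounds every root of Nicolas's identity for `t ≤ 10³⁸`: `ψ − θ ≤ √t + (4/3)t^{1/3}` on `[1, 10³⁸]`
(`psi_sub_theta_le_ofB`; kernel theorem below `2³²`); beyond, Chebyshev's elementary `log 4` (`psi_sub_theta_le_cheb`).  Splitting Nicolas's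
`∫_x^X (ψ − θ)w₀` at `10³⁸` gives `jk_partial_le_ofB`: `≤ 1·F_{1/2}(x) + (4/3)F_{1/3}(x) + 8.9·10⁻²²` for `1 < x ≤ 10³⁸` — `√`-coefficient `1`
instead of `1.021`, absolute excess `0.3863·F_{1/2}(10³⁸) + 0.509·F_{1/3}(10³⁸) ≤ 8.9·10⁻²²` (`Fz_half_1e38_le`, `Fz_third_1e38_le`).

HONEST LABEL: «SPLITTING SEARCH over kernel-typed RH-EQUIVALENCES; a splitting A ∧ B ⟹ RH is CONDITIONAL bookkeeping unless A and B
are both proved; nothing here bears on the truth of RH.»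
-/

set_option linter.dupNamespace false

noncomputable section

open scoped Real Chebyshev ComplexConjugate

namespace Summit.RiemannHypothesis.RiemannHypothesis.Theorems.Splittings.RobinFiniteC1

open Literature.NumberTheory.LFunctions Literature.NumberTheory.DiophantineGeometry
open NicolasJ NicolasFz NicolasK NicolasJExplicit
open Summit.RiemannHypothesis.RiemannHypothesis.Theorems.Splittings.RobinFiniteE1c
open Summit.RiemannHypothesis.RiemannHypothesis.Theorems.Splittings.RobinFiniteE3

section OneFact

open Complex Filter Set MeasureTheory Topology intervalIntegral

/-! ### O1 · `ψ − θ` pointwise from Büthe 2018 alone (`t ≤ 10³⁸`) and from Chebyshev alone (every `t ≥ 1`) -/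

/-- The higher roots from Büthe 2018 alone: `Σ_{4 ≤ k ≤ log₂ t} θ(t^{1/k}) ≤ 0.3289·t^{1/3}` for `2³² ≤ t ≤ 10³⁸`
(every root lies in `[1, 10¹⁹]`, where `θ(y) < y`; the tree's `Σ_{k≥4} t^{1/k − 1/3} ≤ 0.3289`). -/
theorem sum_theta_roots_le_ofB (hB : Buthe2018_thm2_theta) {t : ℝ} (ht : (2 : ℝ) ^ 32 ≤ t) (ht38 : t ≤ 1e38) :
    ∑ k ∈ Finset.Icc 4 ⌊Real.log t / Real.log 2⌋₊, θ (t ^ ((1 : ℝ) / k)) ≤ 0.3289 * t ^ ((1 : ℝ) / 3) := by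
  have ht0 : 0 < t := lt_of_lt_of_le (by norm_num) ht
  have ht1 : 1 ≤ t := le_trans (by norm_num) ht
  have hS := NicolasPsiTheta.sum_rpow_sub_third_le_32 ht
  have h3 : 0 ≤ t ^ ((1 : ℝ) / 3) := by positivity
  have hsqrt : t ^ (1 / 2 : ℝ) ≤ (10 : ℝ) ^ 19 := by
    rw [← Real.sqrt_eq_rpow]
    calc √t ≤ √((1e19 : ℝ) ^ 2) := Real.sqrt_le_sqrt (ht38.trans (by norm_num))
      _ = 1e19 := Real.sqrt_sq (by norm_num)
      _ = (10 : ℝ) ^ 19 := by norm_num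
  have hroot : ∀ k ∈ Finset.Icc 4 ⌊Real.log t / Real.log 2⌋₊, θ (t ^ ((1 : ℝ) / k)) ≤ t ^ ((1 : ℝ) / k) := by
    intro k hk
    have hk4 : 4 ≤ k := (Finset.mem_Icc.1 hk).1
    have hk2 : (2 : ℝ) ≤ k := by exact_mod_cast (le_trans (by norm_num) hk4)
    have hlo : (1 : ℝ) ≤ t ^ ((1 : ℝ) / k) := by
      simpa using Real.rpow_le_rpow zero_le_one ht1 (by positivity : (0 : ℝ) ≤ (1 : ℝ) / k)
    have hhi : t ^ ((1 : ℝ) / k) ≤ (10 : ℝ) ^ 19 := by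
      refine le_trans ?_ hsqrt
      exact Real.rpow_le_rpow_of_exponent_le ht1 (by
        rw [show (1 / 2 : ℝ) = (1 : ℝ) / 2 by norm_num]
        exact div_le_div_of_nonneg_left (by norm_num) (by norm_num) hk2)
    exact (hB.theta_lt hlo hhi).le
  calc ∑ k ∈ Finset.Icc 4 ⌊Real.log t / Real.log 2⌋₊, θ (t ^ ((1 : ℝ) / k))
      ≤ ∑ k ∈ Finset.Icc 4 ⌊Real.log t / Real.log 2⌋₊, t ^ ((1 : ℝ) / k) := Finset.sum_le_sum hroot
    _ = t ^ ((1 : ℝ) / 3) * ∑ k ∈ Finset.Icc 4 ⌊Real.log t / Real.log 2⌋₊, t ^ ((1 : ℝ) / k - 1 / 3) :=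
        NicolasPsiTheta.sum_rpow_eq_mul ht0 _
    _ ≤ t ^ ((1 : ℝ) / 3) * 0.3289 := by gcongr
    _ = 0.3289 * t ^ ((1 : ℝ) / 3) := by ring

/-- **S4 from ONE print fact**: `ψ(t) − θ(t) ≤ √t + (4/3)·t^{1/3}` for `1 ≤ t ≤ 10³⁸`, from Büthe 2018 Thm 2 alone
(`t < 2³²`: the kernel theorem `psi_sub_theta_le_of_lt_two_pow_32`; `2³² ≤ t ≤ 10³⁸`: Nicolas's identity with `θ(√t) ≤ √t`,
`θ(t^{1/3}) ≤ t^{1/3}` — both roots `≤ 10¹⁹` — and `sum_theta_roots_le_ofB`; `1 + 0.3289 ≤ 4/3`).  No BKLNW, no RH. -/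
theorem psi_sub_theta_le_ofB (hB : Buthe2018_thm2_theta) {t : ℝ} (ht : 1 ≤ t) (ht38 : t ≤ 1e38) :
    ψ t - θ t ≤ Real.sqrt t + 4 / 3 * t ^ ((1 : ℝ) / 3) := by
  rcases lt_or_ge t ((2 : ℝ) ^ 32) with h32 | h32
  · exact psi_sub_theta_le_of_lt_two_pow_32 ht h32
  · have ht0 : 0 < t := by linarith
    have h16 : (2 : ℝ) ^ 4 ≤ t := le_trans (by norm_num) h32
    rw [NicolasPsiTheta.psi_sub_theta_eq h16, ← Real.sqrt_eq_rpow]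
    have hs1 : (1 : ℝ) ≤ √t := by
      rw [show (1 : ℝ) = √1 from Real.sqrt_one.symm]
      exact Real.sqrt_le_sqrt ht
    have hs19 : √t ≤ (10 : ℝ) ^ 19 := by
      calc √t ≤ √((1e19 : ℝ) ^ 2) := Real.sqrt_le_sqrt (ht38.trans (by norm_num))
        _ = 1e19 := Real.sqrt_sq (by norm_num)
        _ = (10 : ℝ) ^ 19 := by norm_num
    have hc1 : (1 : ℝ) ≤ t ^ ((1 : ℝ) / 3) := by
      simpa using Real.rpow_le_rpow zero_le_one ht (by norm_num : (0 : ℝ) ≤ (1 : ℝ) / 3)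
    have hc19 : t ^ ((1 : ℝ) / 3) ≤ (10 : ℝ) ^ 19 := by
      refine le_trans (Real.rpow_le_rpow_of_exponent_le ht (by norm_num : (1 : ℝ) / 3 ≤ 1 / 2)) ?_
      rw [← Real.sqrt_eq_rpow]
      exact hs19
    have hθ2 := (hB.theta_lt hs1 hs19).le
    have hθ3 := (hB.theta_lt hc1 hc19).le
    have hsum4 := sum_theta_roots_le_ofB hB h32 ht38
    have h3 : 0 ≤ t ^ ((1 : ℝ) / 3) := by positivity
    linarith

/-- Chebyshev alone, every `t ≥ 1` (print-free): `ψ(t) − θ(t) ≤ 1.3863√t + 1.8423·t^{1/3}` (`t < 2³²`: the kernel theorem is sharper;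
`t ≥ 2³²`: the tree's `psi_sub_theta_le_far`). -/
theorem psi_sub_theta_le_cheb {t : ℝ} (ht : 1 ≤ t) :
    ψ t - θ t ≤ 1.3863 * Real.sqrt t + 1.8423 * t ^ ((1 : ℝ) / 3) := by
  have hs := Real.sqrt_nonneg t
  have h3 : 0 ≤ t ^ ((1 : ℝ) / 3) := Real.rpow_nonneg (by linarith) _
  rcases lt_or_ge t ((2 : ℝ) ^ 32) with h32 | h32
  · have h := psi_sub_theta_le_of_lt_two_pow_32 ht h32
    linarith
  · exact psi_sub_theta_le_far h32

/-! ### O2 · the two weight constants at `10³⁸` and Nicolas's `J − K` with the split at `10³⁸` -/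

/-- `log 10³⁸ ≥ 87.4` (`38·log 10`, `log 10 > 2.3025850925`). -/
theorem log_1e38_ge : (87.4 : ℝ) ≤ Real.log 1e38 := by
  have h10 := RobinAnalytic.log_ten_gt
  have e : Real.log 1e38 = (38 : ℕ) * Real.log 10 := by
    rw [show (1e38 : ℝ) = (10 : ℝ) ^ 38 by norm_num, Real.log_pow]
  rw [e]
  push_cast
  linarith

/-- `F_{1/2}(10³⁸) ≤ 2/(√(10³⁸)·log 10³⁸) ≤ 2/(10¹⁹·87.4) ≤ 2.29·10⁻²¹` (Nicolas 2012 (2.4); the `−2/log² + 8/log³` terms are `≤ 0`). -/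
theorem Fz_half_1e38_le : (Fz (1 / 2 : ℝ) 1e38).re ≤ 2.29e-21 := by
  refine (NicolasFz.Fhalf_le (x := 1e38) (by norm_num)).trans ?_
  have hL := log_1e38_ge
  have hs19 : (1e19 : ℝ) ≤ √(1e38 : ℝ) := (Real.le_sqrt' (by norm_num)).2 (by norm_num)
  set L := Real.log 1e38 with hLdef
  set s := √(1e38 : ℝ) with hsdef
  have hs0 : 0 < s := lt_of_lt_of_le (by norm_num) hs19
  have hL0 : 0 < L := lt_of_lt_of_le (by norm_num) hL
  have hsL2 : 0 < s * L ^ 2 := by positivity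
  have hneg : 8 / (s * L ^ 3) ≤ 2 / (s * L ^ 2) := by
    rw [div_le_div_iff₀ (by positivity) (by positivity)]
    nlinarith [mul_le_mul_of_nonneg_left hL hsL2.le]
  have hmain : 2 / (s * L) ≤ 2.29e-21 := by
    rw [div_le_iff₀ (by positivity)]
    nlinarith [mul_le_mul hs19 hL (by norm_num) hs0.le]
  linarith

/-- `F_{1/3}(10³⁸) ≤ 3/(2·(10³⁸)^{2/3}·log 10³⁸) ≤ 3/(2·2.15·10²⁵·87.4) ≤ 8.1·10⁻²⁸`. -/
theorem Fz_third_1e38_le : (Fz (1 / 3 : ℝ) 1e38).re ≤ 8.1e-28 := by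
  refine (NicolasFz.Fthird_le (x := 1e38) (by norm_num)).trans ?_
  have hlog := log_1e38_ge
  have hpow : (2.15e25 : ℝ) ≤ (1e38 : ℝ) ^ (2 / 3 : ℝ) := by
    rw [show (2 / 3 : ℝ) = ((2 : ℕ) : ℝ) * ((1 : ℝ) / 3) by norm_num, Real.rpow_mul (by norm_num), Real.rpow_natCast]
    have e2 : (2.15e25 : ℝ) = ((2.15e25 : ℝ) ^ (3 : ℕ)) ^ ((1 : ℝ) / 3) := by
      rw [← Real.rpow_natCast, ← Real.rpow_mul (by norm_num)]; norm_num
    rw [e2]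
    exact Real.rpow_le_rpow (by norm_num) (by norm_num) (by norm_num)
  have hden : (2 : ℝ) * 2.15e25 * 87.4 ≤ 2 * (1e38 : ℝ) ^ (2 / 3 : ℝ) * Real.log 1e38 :=
    mul_le_mul (mul_le_mul_of_nonneg_left hpow (by norm_num)) hlog (by norm_num) (by positivity)
  calc 3 / (2 * (1e38 : ℝ) ^ (2 / 3 : ℝ) * Real.log 1e38) ≤ 3 / (2 * 2.15e25 * 87.4) :=
        div_le_div_of_nonneg_left (by norm_num) (by norm_num) hden
    _ ≤ 8.1e-28 := by norm_num

/-- **O2 · Nicolas's Cor. 2.1 upper WITH THE SPLIT AT `10³⁸`, from Büthe 2018 alone**: for `1 < x ≤ 10³⁸` and `X ≥ x`,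
`∫_x^X (ψ − t)w₀ − ∫_x^X (θ − t)w₀ ≤ 1·F_{1/2}(x) + (4/3)·F_{1/3}(x) + 8.9·10⁻²²`
(`[x, min X 10³⁸]`: `psi_sub_theta_le_ofB`, coefficient `1`; beyond: `psi_sub_theta_le_cheb`; excess
`0.3863·F_{1/2}(10³⁸) + 0.509·F_{1/3}(10³⁸) ≤ 8.9·10⁻²²`).  The tree's S4 (`jk_partial_le` with `c = 1.021` on all of `[x, ∞)`) needs BKLNW 2021. -/
theorem jk_partial_le_ofB (hB : Buthe2018_thm2_theta) {x X : ℝ} (hx : 1 < x) (hx38 : x ≤ 1e38) (hX : x ≤ X) :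
    (∫ t in x..X, (ψ t - t) * w0 t) - ∫ t in x..X, (θ t - t) * w0 t ≤
      (Fz (1 / 2 : ℝ) x).re + 4 / 3 * (Fz (1 / 3 : ℝ) x).re + 8.9e-22 := by
  set p : ℝ := min X 1e38 with hp
  have hxp : x ≤ p := le_min hX hx38
  have hpX : p ≤ X := min_le_left _ _
  have hp1 : 1 < p := lt_of_lt_of_le hx hxp
  have hpB : p ≤ 1e38 := min_le_right _ _
  -- the integrand `(ψ − θ)·w₀`
  have hf : ∀ a b : ℝ, 1 < a → a ≤ b → IntervalIntegrable (fun t ↦ (ψ t - θ t) * w0 t) volume a b := by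
    intro a b ha hab
    exact ((intervalIntegrable_R_mul_w0 ha hab).sub (intervalIntegrable_S_mul_w0 ha hab)).congr fun t _ ↦ by ring
  have hev : ∀ a b c₂ c₃ : ℝ, 1 < a → a ≤ b →
      ∫ t in a..b, (c₂ * (t ^ (1 / 2 : ℝ) * w0 t) + c₃ * (t ^ ((1 : ℝ) / 3) * w0 t)) =
        c₂ * (∫ t in a..b, t ^ (1 / 2 : ℝ) * w0 t) + c₃ * ∫ t in a..b, t ^ ((1 : ℝ) / 3) * w0 t := by
    intro a b c₂ c₃ ha hab
    rw [intervalIntegral.integral_add ((intervalIntegrable_rpow_mul_w0 (1 / 2) ha hab).const_mul c₂)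
        ((intervalIntegrable_rpow_mul_w0 ((1 : ℝ) / 3) ha hab).const_mul c₃),
      intervalIntegral.integral_const_mul, intervalIntegral.integral_const_mul]
  -- pointwise domination on a piece
  have hdom : ∀ {a b c₂ c₃ : ℝ}, 1 < a → a ≤ b →
      (∀ t : ℝ, a ≤ t → t ≤ b → ψ t - θ t ≤ c₂ * Real.sqrt t + c₃ * t ^ ((1 : ℝ) / 3)) →
      ∫ t in a..b, (ψ t - θ t) * w0 t ≤
        c₂ * (∫ t in a..b, t ^ (1 / 2 : ℝ) * w0 t) + c₃ * ∫ t in a..b, t ^ ((1 : ℝ) / 3) * w0 t := by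
    intro a b c₂ c₃ ha hab hpt
    rw [← hev a b c₂ c₃ ha hab]
    refine intervalIntegral.integral_mono_on hab (hf a b ha hab)
      (((intervalIntegrable_rpow_mul_w0 (1 / 2) ha hab).const_mul c₂).add
        ((intervalIntegrable_rpow_mul_w0 ((1 : ℝ) / 3) ha hab).const_mul c₃)) fun t ht ↦ ?_
    have ht1 : 1 < t := ha.trans_le ht.1
    have h := hpt t ht.1 ht.2
    rw [Real.sqrt_eq_rpow] at h
    have hw := (w0_pos ht1).le
    calc (ψ t - θ t) * w0 t ≤ (c₂ * t ^ (1 / 2 : ℝ) + c₃ * t ^ ((1 : ℝ) / 3)) * w0 t :=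
          mul_le_mul_of_nonneg_right h hw
      _ = _ := by ring
  -- J − K as one integral, split at p
  have hiψ := intervalIntegrable_R_mul_w0 hx hX
  have hiθ := intervalIntegrable_S_mul_w0 hx hX
  rw [← intervalIntegral.integral_sub hiψ hiθ]
  have hsimp : ∫ t in x..X, ((ψ t - t) * w0 t - (θ t - t) * w0 t) = ∫ t in x..X, (ψ t - θ t) * w0 t :=
    intervalIntegral.integral_congr fun t _ ↦ by ring
  rw [hsimp]
  have hsplit : ∫ t in x..X, (ψ t - θ t) * w0 t =
      (∫ t in x..p, (ψ t - θ t) * w0 t) + ∫ t in p..X, (ψ t - θ t) * w0 t := by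
    rw [intervalIntegral.integral_add_adjacent_intervals (hf x p hx hxp) (hf p X hp1 hpX)]
  -- the two pieces
  have hI₁ := hdom hx hxp (c₂ := 1) (c₃ := 4 / 3) fun t ht htb ↦ by
    have h := psi_sub_theta_le_ofB hB (hx.le.trans ht) (htb.trans hpB)
    linarith
  have hI₂ := hdom hp1 hpX (c₂ := 1.3863) (c₃ := 1.8423) fun t ht _ ↦ psi_sub_theta_le_cheb (hp1.le.trans ht)
  -- the basic integrals recombined
  have hS : (∫ t in x..p, t ^ (1 / 2 : ℝ) * w0 t) + (∫ t in p..X, t ^ (1 / 2 : ℝ) * w0 t) ≤ (Fz (1 / 2 : ℝ) x).re := by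
    rw [intervalIntegral.integral_add_adjacent_intervals (intervalIntegrable_rpow_mul_w0 _ hx hxp)
        (intervalIntegrable_rpow_mul_w0 _ hp1 hpX)]
    exact integral_rpow_mul_w0_le_Fz (a := 1 / 2) (by norm_num) hx hX
  have hC : (∫ t in x..p, t ^ ((1 : ℝ) / 3) * w0 t) + (∫ t in p..X, t ^ ((1 : ℝ) / 3) * w0 t) ≤ (Fz (1 / 3 : ℝ) x).re := by
    rw [intervalIntegral.integral_add_adjacent_intervals (intervalIntegrable_rpow_mul_w0 _ hx hxp)
        (intervalIntegrable_rpow_mul_w0 _ hp1 hpX)]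
    have h := integral_rpow_mul_w0_le_Fz (a := (1 : ℝ) / 3) (by norm_num) hx hX
    rw [show ((1 : ℝ) / 3) = (1 / 3 : ℝ) by norm_num] at h ⊢
    exact h
  -- the two truncation constants
  have hS2 : (∫ t in p..X, t ^ (1 / 2 : ℝ) * w0 t) ≤ 2.29e-21 := by
    rcases le_total X 1e38 with hXB | hBX
    · have e : p = X := min_eq_left hXB
      rw [e, intervalIntegral.integral_same]
      norm_num
    · have e : p = 1e38 := min_eq_right hBX
      rw [e]
      exact (integral_rpow_mul_w0_le_Fz (a := 1 / 2) (by norm_num) (by norm_num : (1 : ℝ) < 1e38) hBX).trans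
        Fz_half_1e38_le
  have hC2 : (∫ t in p..X, t ^ ((1 : ℝ) / 3) * w0 t) ≤ 8.1e-28 := by
    rcases le_total X 1e38 with hXB | hBX
    · have e : p = X := min_eq_left hXB
      rw [e, intervalIntegral.integral_same]
      norm_num
    · have e : p = 1e38 := min_eq_right hBX
      rw [e]
      have h := integral_rpow_mul_w0_le_Fz (a := (1 : ℝ) / 3) (by norm_num) (by norm_num : (1 : ℝ) < 1e38) hBX
      rw [show ((1 : ℝ) / 3) = (1 / 3 : ℝ) by norm_num] at h ⊢
      exact h.trans Fz_third_1e38_le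
  -- nonnegativity of the pieces
  have hS1 : 0 ≤ ∫ t in x..p, t ^ (1 / 2 : ℝ) * w0 t :=
    intervalIntegral.integral_nonneg hxp fun t ht ↦
      mul_nonneg (Real.rpow_nonneg (by linarith [ht.1]) _) (w0_pos (hx.trans_le ht.1)).le
  have hC1 : 0 ≤ ∫ t in x..p, t ^ ((1 : ℝ) / 3) * w0 t :=
    intervalIntegral.integral_nonneg hxp fun t ht ↦
      mul_nonneg (Real.rpow_nonneg (by linarith [ht.1]) _) (w0_pos (hx.trans_le ht.1)).le
  have hS2' : 0 ≤ ∫ t in p..X, t ^ (1 / 2 : ℝ) * w0 t :=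
    intervalIntegral.integral_nonneg hpX fun t ht ↦
      mul_nonneg (Real.rpow_nonneg (by linarith [ht.1]) _) (w0_pos (hp1.trans_le ht.1)).le
  have hC2' : 0 ≤ ∫ t in p..X, t ^ ((1 : ℝ) / 3) * w0 t :=
    intervalIntegral.integral_nonneg hpX fun t ht ↦
      mul_nonneg (Real.rpow_nonneg (by linarith [ht.1]) _) (w0_pos (hp1.trans_le ht.1)).le
  rw [hsplit]
  linarith [hI₁, hI₂, hS, hC, hS2, hC2, hS1, hC1, hS2', hC2']

end OneFact

end Summit.RiemannHypothesis.RiemannHypothesis.Theorems.Splittings.RobinFiniteC1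

end
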